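import Literature.NumberTheory.PAdicHodge.AinfRamifiedDivisionTransport
import HarnessLib

/-!
# The cell models in the currency of the transported reciprocity law: `Wm := W_D.map (CoeffDisc.of D)` with `ℤ_p`-integer coefficients
# `a, b ∈ ℤ` IS the explicit model of `map_explicitModel_eq_map_cmFibre`, hence `W_D ≡ E₀ (mod ϖ)` (`hWE`) for it

Topic `Literature/NumberTheory/PAdicHodge`; namespace `Literature.NumberTheory.PAdicHodge`. THEOREMS ONLY (no definition, no named fact, no instance, no
`sorry`). Book-keeping between the two spellings of the K★ cell models: the ramified-period files and the Tate-module witness / (N1′) files use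
`(⟨0,0,0, AdjoinRoot.of D.poly a · root^{r₄}, AdjoinRoot.of D.poly b · root^{r₆}⟩ : WeierstrassCurve D.Coeff).map (CoeffDisc.of D)` (`a b : ℤ_[p]`), while
the congruence `W_D ≡ E₀ (mod ϖ)` (`AinfRamifiedDivisionTransport.map_explicitModel_eq_map_cmFibre`, the hypothesis `hWE` of
`BmaxPlusTransportedReciprocity*` / `Summits/…/…TransportedReciprocity*`) is stated for `⟨0,0,0, algebraMap ℤ (CoeffDisc D) a · ϱ^{r₄}, …⟩` with `a b : ℤ`.
For INTEGER `a, b` (the cells: `a = −27A`, `b = −54B` with `c₄ = p^m A`, `c₆ = p^n B`) the two coincide: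

* `map_model_of_eq_explicitModel` — the two spellings are equal;
* ★ `map_model_of_map_mk_eq_map_cmFibre` — **`hWE` for `Wm := W_D.map (CoeffDisc.of D)`** with `E₀ = ⟨0,0,0,(r₄=0?a:0),(r₆=0?b:0)⟩`.

Purpose: crux K★ `stmt-BirchSwinnertonDyer-22226` (route `EdixhovenFibreFiveSeven`, line `kato_lever`), memo
`Summits/…/Cruxes/StarredOptimalManinUnitFiveSeven/Lines/kato-lever-K2-transport-allpoints.md` §4 (row `E₀, hWE`). Infrastructure only; BSD / K★ are not proved by this.

## References
* J. H. Silverman, *AEC* (2009), VII.§1. [SilvermanAEC2009]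
-/

noncomputable section

open scoped Classical
open Polynomial Field ValuativeRel

namespace Literature.NumberTheory.PAdicHodge

open Literature.NumberTheory.GaloisRepresentations Literature.NumberTheory.GaloisRepresentations.IsNonarchimedeanLocalField

variable {F : Type} [Field F] [ValuativeRel F] [TopologicalSpace F] [IsNonarchimedeanLocalField F] [CharZero F]
  {p : ℕ} [Fact p.Prime] {hp : valuation F p < 1} (D : EisensteinRoot F p hp) (a b : ℤ) (r₄ r₆ : ℕ)

/-- The two spellings of the cell model agree for integer `a, b`: `(W_D over D.Coeff).map (CoeffDisc.of D) = ⟨0,0,0, a·ϱ^{r₄}, b·ϱ^{r₆}⟩` over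
`CoeffDisc D` (`ℤ → ℤ_p → 𝒪_D → CoeffDisc D` is `algebraMap ℤ (CoeffDisc D)`). [cite: SilvermanAEC2009, VII.§1] -/
theorem map_model_of_eq_explicitModel :
    ((⟨0, 0, 0, AdjoinRoot.of D.poly (a : ℤ_[p]) * AdjoinRoot.root D.poly ^ r₄, AdjoinRoot.of D.poly (b : ℤ_[p]) * AdjoinRoot.root D.poly ^ r₆⟩ :
        WeierstrassCurve D.Coeff).map (EisensteinRoot.CoeffDisc.of D).toRingHom) =
      ⟨0, 0, 0, algebraMap ℤ (EisensteinRoot.CoeffDisc D) a * EisensteinRoot.CoeffDisc.of D (AdjoinRoot.root D.poly) ^ r₄,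
        algebraMap ℤ (EisensteinRoot.CoeffDisc D) b * EisensteinRoot.CoeffDisc.of D (AdjoinRoot.root D.poly) ^ r₆⟩ := by
  have hint : ∀ c : ℤ, (EisensteinRoot.CoeffDisc.of D).toRingHom (AdjoinRoot.of D.poly (c : ℤ_[p])) = algebraMap ℤ (EisensteinRoot.CoeffDisc D) c :=
    fun c => by rw [map_intCast, map_intCast, eq_intCast]
  ext <;> simp only [WeierstrassCurve.map_a₁, WeierstrassCurve.map_a₂, WeierstrassCurve.map_a₃, WeierstrassCurve.map_a₄, WeierstrassCurve.map_a₆,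
    map_zero, map_mul, map_pow, hint] <;> rfl

/-- ★ **`hWE` for the cell model in the `CoeffDisc.of`-spelling**: `Wm := W_D.map (CoeffDisc.of D)` (integer `a, b`) is congruent mod `ϖ` to
`E₀ = ⟨0,0,0,(r₄=0?a:0),(r₆=0?b:0)⟩` — the hypothesis `hWE` of the transported reciprocity law for the K★ cells
(`map_explicitModel_eq_map_cmFibre` read through `map_model_of_eq_explicitModel`). [cite: SilvermanAEC2009, VII.§1] -/
theorem map_model_of_map_mk_eq_map_cmFibre :
    (((⟨0, 0, 0, AdjoinRoot.of D.poly (a : ℤ_[p]) * AdjoinRoot.root D.poly ^ r₄, AdjoinRoot.of D.poly (b : ℤ_[p]) * AdjoinRoot.root D.poly ^ r₆⟩ :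
        WeierstrassCurve D.Coeff).map (EisensteinRoot.CoeffDisc.of D).toRingHom).map
      (Ideal.Quotient.mk (Ideal.span {EisensteinRoot.CoeffDisc.of D (AdjoinRoot.root D.poly)}))) =
    ((⟨0, 0, 0, if r₄ = 0 then a else 0, if r₆ = 0 then b else 0⟩ : WeierstrassCurve ℤ).map
        (algebraMap ℤ (EisensteinRoot.CoeffDisc D))).map
      (Ideal.Quotient.mk (Ideal.span {EisensteinRoot.CoeffDisc.of D (AdjoinRoot.root D.poly)})) := by
  rw [map_model_of_eq_explicitModel]
  exact map_explicitModel_eq_map_cmFibre D a b r₄ r₆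

end Literature.NumberTheory.PAdicHodge

end
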